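import Literature.NumberTheory.QuadraticFields.ScholzHeckeUnitCriterion
import Literature.Computability.Complexity.AdaptiveFunctions
import Literature.Computability.Complexity.OracleClosure
import Literature.Computability.QuantumComplexity.BQPJoinClosure
import Literature.Computability.Cryptography.VanDamSeroussiOracleBQP

/-!
# ArithStatLadder / `AvgFaceBeyondPrior`, line `mirror-unit-signature`: the unit language is in `BQP`
# given the factor-bit language and the certified unit language (stub `stub_unitCubeMemBQP`)

Crux `stmt-QuantumAdvantage-2427`, registered stub `stub_unitCubeMemBQP` of the line's skeleton: with

* `FB = {⟨bin N, u⟩ : bit |u| of code(primeFactorsList N) is 1}` (the factor-bit language) and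
* `CU = {⟨bin d, code(primeFactorsList d)⟩ : −d fundamental, d ≠ 3, UnitCubeAtThree d}` (the CERTIFIED
  unit language)

both in `BQP`, the plain unit language `L_ε = bin {d : −d fundamental, d ≠ 3, UnitCubeAtThree d}` is in
`BQP`. Proof (a classical adaptive transducer with ONE joined oracle, no circuit is written here):

* `A := FB ⊕ CU ∈ BQP` (`oracleJoin_mem_BQP`, Bennett–Bernstein–Brassard–Vazirani 1997, Cor. 4.15);
* the adaptive oracle transducer `adFn Q (p+1) G A` (Ladner–Lynch–Selman 1975, §2; `AdaptiveFunctions.lean`)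
  on input `x` asks `0·⟨x, 1ⁱ⟩` for `i < p(|x|)` — the answers spell the zero-padded window
  `code(primeFactorsList d) 0⋯0` of length `p(|x|)`, `d = ⟦x⟧` (`adBits_window`) —, parses the factor
  list back from the window (`VDSOracle.parseF_certCode_append`: the list code is self-delimiting),
  asks ONCE `1·⟨x, code(primeFactorsList d)⟩`, i.e. `CU`, and outputs that answer bit, resp. `0` on a
  non-canonical numeral `x` (`adFn_eq_bit`); `Q, G ∈ FP` by the typed `CodeFP` algebra
  (`exists_queryFn`, `exists_outFn`), the window bound `p = 2(|x|+1)²` by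
  `length_certCode_primeFactorsList_le`;
* `adFn Q (p+1) G A ∘ fstF ∈ FP^A` (`adFn_mem_FPRel`, `comp_FP_mem_FPRel`) solves the extension-closed
  relation `{z | [x ∈ L_ε] <+: z}` on EVERY coin string, so `isQSolvable_of_mem_FPRel_BQP_holds`
  (`BPP^{BQP}` search ⊆ `FBQP`) and `mem_BQP_of_isQSolvable_bit` (decision from the written bit) give
  `L_ε ∈ BQP` (`toLanguage_mem_BQP_of_oracles`, `stub_unitCubeMemBQP`).

## References

* C. H. Bennett, E. Bernstein, G. Brassard, U. Vazirani, SIAM J. Comput. 26 (1997), Cor. 4.15.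
* R. E. Ladner, N. A. Lynch, A. L. Selman, Theoret. Comput. Sci. 1 (1975), §2.
* S. Arora, B. Barak, *Computational Complexity: A Modern Approach*, CUP 2009, §3.4, §17.2.1.
-/

set_option linter.dupNamespace false -- D-0017: single-problem summit ⇒ `QuantumAdvantage.QuantumAdvantage` by design

namespace Summit.QuantumAdvantage.QuantumAdvantage.Theorems.AvgFaceBeyondPrior.Mirror

open _root_.Computability Polynomial
open Literature.Computability.Complexity Literature.Computability.Cryptography
  Literature.NumberTheory.QuadraticFields
open Literature.Computability.Complexity.Brick Literature.Computability.Complexity.CodeFP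
  Literature.Computability.Complexity.AdQuery
open VDSOracle (certCode parseF parseF_certCode_append codeFP_parseF)

/-! ### Answer strings of prefix-reading queries -/

/-- **Answer strings that read a fixed string bit by bit.** If, as long as fewer than `|W|` answers are
in, the oracle's answer to the query computed from the `i`-prefix of `W` is bit `i` of `W`, then after
`i ≤ |W|` rounds the answer string IS the `i`-prefix of `W` (induction on `i`; the shape of binary search /
bit reading with an oracle). [cite: AroraBarak2009, §17.2.1] -/
theorem adBits_eq_take {Q : List Bool → List Bool} {A : Language Bool} {x W : List Bool}
    (h : ∀ i < W.length, A.boolIndicator (Q (boolPair x (W.take i))) = W.getD i false) :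
    ∀ i ≤ W.length, adBits Q A x i = W.take i
  | 0, _ => by simp
  | i + 1, hi => by
    rw [adBits_succ, adBits_eq_take h i (Nat.le_of_succ_le hi), h i hi, List.take_add_one,
      List.getD_eq_getElem?_getD, List.getElem?_eq_getElem hi]
    rfl

/-! ### The window bound: `|code(primeFactorsList n)| ≤ 2(|bin n| + 1)²` -/

/-- The factor list of `n` has at most `|bin n|` entries and each entry has at most `|bin n|` bits, so
its self-delimiting code `listE bin` has length `≤ 2|F| + 2 + |F|(2|bin n| + 2) ≤ 2(|bin n|+1)²`. [folklore] -/
theorem length_certCode_primeFactorsList_le (n : ℕ) :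
    (certCode n.primeFactorsList).length ≤ 2 * ((encodeNat n).length + 1) ^ 2 := by
  have hm : (encodeNat n).length = n.size := TM2Pass.length_encodeNat_eq_size n
  have hF : n.primeFactorsList.length ≤ (encodeNat n).length := by
    rcases Nat.eq_zero_or_pos n with rfl | hn
    · simp
    · have h1 := List.pow_card_le_prod n.primeFactorsList 2 fun x hx =>
        (Nat.prime_of_mem_primeFactorsList hx).two_le
      rw [Nat.prod_primeFactorsList hn.ne'] at h1
      have h2 : n < 2 ^ n.size := Nat.lt_size_self n
      have h3 := (Nat.pow_lt_pow_iff_right (by norm_num : 1 < 2)).1 (h1.trans_lt h2)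
      omega
  have hitem : ∀ a ∈ n.primeFactorsList, 2 * (natE a).length + 2 ≤ 2 * (encodeNat n).length + 2 := by
    intro a ha
    have : (natE a).length ≤ (encodeNat n).length := by
      rw [natE, TM2Pass.length_encodeNat_eq_size, hm]
      exact Nat.size_le_size (Nat.le_of_mem_primeFactorsList ha)
    omega
  have hsum := List.sum_le_card_nsmul _ _ fun x hx => by
    obtain ⟨a, ha, rfl⟩ := List.mem_map.1 hx
    exact hitem a ha
  rw [List.length_map, smul_eq_mul] at hsum
  rw [certCode, listE, length_boolPair, length_unE, length_rawE]
  set m := (encodeNat n).length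
  set k := n.primeFactorsList.length
  have hk : k * (2 * m + 2) ≤ m * (2 * m + 2) := Nat.mul_le_mul_right _ hF
  nlinarith [hsum, hk]

/-! ### The two classical maps of the transducer are polynomial time -/

/-- **The query generator is in `FP`**: on `⟨x, answers⟩`, while fewer than `p(|x|)` answers are in,
the factor-bit query `0·⟨x, 1^{#answers}⟩`; afterwards the certified-unit query `1·⟨x, code(F)⟩` with `F`
the list parsed from the first `p(|x|)` answers (typed `CodeFP` algebra: `fstF`, `sndF`, `polyFn`, unary
comparison, `cons_mem_FP`, `VDSOracle.codeFP_parseF`, `listOfRaw`). [cite: AroraBarak2009, §1.3] -/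
theorem exists_queryFn (p : Polynomial ℕ) :
    ∃ Q : List Bool → List Bool, Q ∈ FP ∧ ∀ x ans : List Bool, Q (boolPair x ans) =
      if ans.length < p.eval x.length then false :: boolPair x (unE ans.length)
      else true :: boolPair x (certCode (parseF (ans.take (p.eval x.length)))) := by
  have hx : CodeFP strE strE fstF := of_fn fstF fstF_mem_FP fun _ => rfl
  have hb : CodeFP strE strE sndF := of_fn sndF sndF_mem_FP fun _ => rfl
  have hpoly : CodeFP strE unE (fun w => p.eval w.length) :=
    of_fn (Plumb.polyFn p) (Plumb.polyFn_mem_FP p) fun w => by rw [Plumb.polyFn_apply, unE_eq_ones]; rfl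
  have hP : CodeFP strE unE (fun z => p.eval (fstF z).length) := hpoly.comp hx
  have hlen : CodeFP strE unE (fun z => (sndF z).length) := strLength.comp hb
  have hlt : CodeFP strE bitE (fun z => decide ((sndF z).length < p.eval (fstF z).length)) :=
    natLt.comp ((natOfUn.comp hlen).pair (natOfUn.comp hP))
  have hq1 : CodeFP strE strE (fun z => boolPair (fstF z) (unE (sndF z).length)) :=
    (hx.pair (strOfUn.comp hlen)).recodeOut fun _ => rfl
  have hcons : ∀ b : Bool, CodeFP strE strE (List.cons b) := fun b =>
    of_fn (List.cons b) (cons_mem_FP b) fun _ => rfl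
  have h1 : CodeFP strE strE (fun z => false :: boolPair (fstF z) (unE (sndF z).length)) :=
    (hcons false).comp hq1
  have hcode : CodeFP (rawE natE) strE certCode := (listOfRaw natE).recodeOut fun _ => rfl
  have hq2 : CodeFP strE strE (fun z => boolPair (fstF z) (certCode (parseF ((sndF z).take (p.eval (fstF z).length))))) :=
    (hx.pair (hcode.comp (codeFP_parseF.comp (strTake.comp (hP.pair hb))))).recodeOut fun _ => rfl
  have h2 : CodeFP strE strE
      (fun z => true :: boolPair (fstF z) (certCode (parseF ((sndF z).take (p.eval (fstF z).length))))) :=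
    (hcons true).comp hq2
  obtain ⟨Q, hQ, hQeq⟩ := hlt.ite h1 h2
  refine ⟨Q, hQ, fun x ans => ?_⟩
  have h := hQeq (boolPair x ans)
  simp only [strE, id, fstF_boolPair, sndF_boolPair] at h
  rw [h]
  by_cases hc : ans.length < p.eval x.length
  · rw [if_pos hc, decide_eq_true hc, if_pos rfl]
  · rw [if_neg hc, decide_eq_false hc, if_neg Bool.false_ne_true]

/-- **The output map is in `FP`**: on `⟨x, answers⟩`, the one-bit string
`[x is a canonical numeral ∧ answer number p(|x|) is 1]` (typed `CodeFP` algebra: equality of strings,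
`strOfNat ∘ strVal` re-encodes `⟦x⟧`, bit access `strGetD`). [cite: AroraBarak2009, §1.3] -/
theorem exists_outFn (p : Polynomial ℕ) :
    ∃ G : List Bool → List Bool, G ∈ FP ∧ ∀ x bits : List Bool, G (boolPair x bits) =
      [decide (encodeNat (bitsToNat x) = x) && bits.getD (p.eval x.length) false] := by
  have hx : CodeFP strE strE fstF := of_fn fstF fstF_mem_FP fun _ => rfl
  have hb : CodeFP strE strE sndF := of_fn sndF sndF_mem_FP fun _ => rfl
  have hpoly : CodeFP strE unE (fun w => p.eval w.length) :=
    of_fn (Plumb.polyFn p) (Plumb.polyFn_mem_FP p) fun w => by rw [Plumb.polyFn_apply, unE_eq_ones]; rfl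
  have hcanon : CodeFP strE bitE (fun z => decide (encodeNat (bitsToNat (fstF z)) = fstF z)) :=
    (CodeFP.eq (eα := strE) Function.injective_id).comp (((strOfNat.comp strVal).comp hx).pair hx)
  have hbit : CodeFP strE bitE (fun z => (sndF z).getD (p.eval (fstF z).length) false) :=
    strGetD.comp ((hpoly.comp hx).pair hb)
  have hout : CodeFP strE strE (fun z =>
      [decide (encodeNat (bitsToNat (fstF z)) = fstF z) && (sndF z).getD (p.eval (fstF z).length) false]) :=
    (hcanon.and hbit).recodeOut fun _ => rfl
  obtain ⟨G, hG, hGeq⟩ := hout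
  refine ⟨G, hG, fun x bits => ?_⟩
  have h := hGeq (boolPair x bits)
  simp only [strE, id, fstF_boolPair, sndF_boolPair] at h
  exact h

/-! ### The answer bits of the transducer against `FB ⊕ CU` -/

section Transducer

variable {FB CU : Language Bool} {Q G : List Bool → List Bool} {p : Polynomial ℕ}

/-- **The first `p(|x|)` answers are the zero-padded window of the factor-list code**: on the canonical
numeral `x = bin d` with `|code(primeFactorsList d)| ≤ p(|x|)`, for `i ≤ p(|x|)` the answer string after
`i` rounds is the `i`-prefix of `code(primeFactorsList d) 0^{p(|x|) − |code|}` (each query `0·⟨x, 1ⁱ⟩` is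
answered by `FB`, i.e. by bit `i` of the code). [cite: AroraBarak2009, §17.2.1] -/
theorem adBits_window
    (hQ : ∀ x ans : List Bool, Q (boolPair x ans) =
      if ans.length < p.eval x.length then false :: boolPair x (unE ans.length)
      else true :: boolPair x (certCode (parseF (ans.take (p.eval x.length)))))
    (hFB : ∀ (N : ℕ) (u : List Bool),
      boolPair (encodeNat N) u ∈ FB ↔ (certCode N.primeFactorsList).getD u.length false = true)
    (d : ℕ) (hc : (certCode d.primeFactorsList).length ≤ p.eval (encodeNat d).length) :
    ∀ i ≤ p.eval (encodeNat d).length,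
      adBits Q (oracleJoin FB CU) (encodeNat d) i =
        (certCode d.primeFactorsList ++
          List.replicate (p.eval (encodeNat d).length - (certCode d.primeFactorsList).length) false).take i := by
  have hW : (certCode d.primeFactorsList ++
      List.replicate (p.eval (encodeNat d).length - (certCode d.primeFactorsList).length) false).length =
        p.eval (encodeNat d).length := by
    rw [List.length_append, List.length_replicate]; omega
  intro i hi
  refine adBits_eq_take (fun j hj => ?_) i (hi.trans_eq hW.symm)
  rw [hQ, List.length_take_of_le hj.le, if_pos (by omega), boolIndicator_oracleJoin_false_cons]
  -- bit `j` of the zero-padded window is bit `j` of the code (default `false` past its end)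
  have hget : (certCode d.primeFactorsList ++
      List.replicate (p.eval (encodeNat d).length - (certCode d.primeFactorsList).length) false).getD j false =
        (certCode d.primeFactorsList).getD j false := by
    rw [List.getD_eq_getElem?_getD, List.getD_eq_getElem?_getD]
    by_cases hjc : j < (certCode d.primeFactorsList).length
    · rw [List.getElem?_append_left hjc]
    · rw [List.getElem?_append_right (not_lt.1 hjc), List.getElem?_eq_none (not_lt.1 hjc),
        List.getElem?_replicate]
      split_ifs <;> rfl
  rw [hget]
  -- and `FB` answers the query `⟨bin d, 1ʲ⟩` by that bit
  cases hb : (certCode d.primeFactorsList).getD j false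
  · exact (Set.notMem_iff_boolIndicator _ _).1 fun hm => by
      have h1 := (hFB d (unE j)).1 hm
      rw [length_unE, hb] at h1
      exact Bool.false_ne_true h1
  · exact (Set.mem_iff_boolIndicator _ _).1 ((hFB d (unE j)).2 (by rw [length_unE, hb]))

/-- **The last answer is the certified-unit bit**: after the window, round `p(|x|)` parses the factor
list back (`parseF_certCode_append`), asks `1·⟨x, code(primeFactorsList d)⟩`, answered by `CU`. [folklore] -/
theorem adBits_last
    (hQ : ∀ x ans : List Bool, Q (boolPair x ans) =
      if ans.length < p.eval x.length then false :: boolPair x (unE ans.length)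
      else true :: boolPair x (certCode (parseF (ans.take (p.eval x.length)))))
    (hFB : ∀ (N : ℕ) (u : List Bool),
      boolPair (encodeNat N) u ∈ FB ↔ (certCode N.primeFactorsList).getD u.length false = true)
    (d : ℕ) (hc : (certCode d.primeFactorsList).length ≤ p.eval (encodeNat d).length) :
    adBits Q (oracleJoin FB CU) (encodeNat d) (p.eval (encodeNat d).length + 1) =
      (certCode d.primeFactorsList ++
          List.replicate (p.eval (encodeNat d).length - (certCode d.primeFactorsList).length) false) ++
        [CU.boolIndicator (boolPair (encodeNat d) (certCode d.primeFactorsList))] := by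
  have hW : (certCode d.primeFactorsList ++
      List.replicate (p.eval (encodeNat d).length - (certCode d.primeFactorsList).length) false).length =
        p.eval (encodeNat d).length := by
    rw [List.length_append, List.length_replicate]; omega
  rw [adBits_succ, adBits_window hQ hFB d hc _ le_rfl, List.take_of_length_le hW.le, hQ, hW,
    if_neg (lt_irrefl _), List.take_of_length_le hW.le, parseF_certCode_append,
    boolIndicator_oracleJoin_true_cons]

/-- **The transducer outputs the certified-unit bit on canonical numerals.** [folklore] -/
theorem adFn_encodeNat
    (hQ : ∀ x ans : List Bool, Q (boolPair x ans) =
      if ans.length < p.eval x.length then false :: boolPair x (unE ans.length)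
      else true :: boolPair x (certCode (parseF (ans.take (p.eval x.length)))))
    (hG : ∀ x bits : List Bool, G (boolPair x bits) =
      [decide (encodeNat (bitsToNat x) = x) && bits.getD (p.eval x.length) false])
    (hFB : ∀ (N : ℕ) (u : List Bool),
      boolPair (encodeNat N) u ∈ FB ↔ (certCode N.primeFactorsList).getD u.length false = true)
    (d : ℕ) (hc : (certCode d.primeFactorsList).length ≤ p.eval (encodeNat d).length) :
    adFn Q (p + 1) G (oracleJoin FB CU) (encodeNat d) =
      [CU.boolIndicator (boolPair (encodeNat d) (certCode d.primeFactorsList))] := by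
  have hW : (certCode d.primeFactorsList ++
      List.replicate (p.eval (encodeNat d).length - (certCode d.primeFactorsList).length) false).length =
        p.eval (encodeNat d).length := by
    rw [List.length_append, List.length_replicate]; omega
  rw [adFn_apply, eval_add, eval_one, adBits_last hQ hFB d hc, hG, bitsToNat_encodeNat, decide_eq_true rfl,
    Bool.true_and, List.getD_eq_getElem?_getD, List.getElem?_append_right hW.le, hW, Nat.sub_self]
  rfl

/-- **The transducer computes the bit `[x canonical ∧ ⟨x, code(primeFactorsList ⟦x⟧)⟩ ∈ CU]`** on every
input, given the window bound for `p`. [folklore] -/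
theorem adFn_eq_bit
    (hQ : ∀ x ans : List Bool, Q (boolPair x ans) =
      if ans.length < p.eval x.length then false :: boolPair x (unE ans.length)
      else true :: boolPair x (certCode (parseF (ans.take (p.eval x.length)))))
    (hG : ∀ x bits : List Bool, G (boolPair x bits) =
      [decide (encodeNat (bitsToNat x) = x) && bits.getD (p.eval x.length) false])
    (hFB : ∀ (N : ℕ) (u : List Bool),
      boolPair (encodeNat N) u ∈ FB ↔ (certCode N.primeFactorsList).getD u.length false = true)
    (hp : ∀ n : ℕ, (certCode n.primeFactorsList).length ≤ p.eval (encodeNat n).length) (x : List Bool) :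
    adFn Q (p + 1) G (oracleJoin FB CU) x =
      [decide (encodeNat (bitsToNat x) = x) &&
        CU.boolIndicator (boolPair x (certCode (bitsToNat x).primeFactorsList))] := by
  by_cases h : encodeNat (bitsToNat x) = x
  · obtain ⟨d, rfl⟩ : ∃ d, x = encodeNat d := ⟨_, h.symm⟩
    simp only [bitsToNat_encodeNat, decide_true, Bool.true_and]
    exact adFn_encodeNat hQ hG hFB d (hp d)
  · rw [adFn_apply, hG, decide_eq_false h, Bool.false_and, Bool.false_and]

end Transducer

/-! ### Assembly -/

/-- **Decision with two `BQP` oracles through one join.** If `FB` answers the factor bits of `bin N` and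
membership of `⟨bin d, code(primeFactorsList d)⟩` in `CU` is membership of `d` in `S`, then
`FB, CU ∈ BQP` imply `bin S ∈ BQP`: the adaptive transducer above is an `FP^{FB ⊕ CU}` function
(`adFn_mem_FPRel`, `comp_FP_mem_FPRel`) writing `[x ∈ bin S]` on every coin string, `FB ⊕ CU ∈ BQP`
(`oracleJoin_mem_BQP`), so the classical-base principle `isQSolvable_of_mem_FPRel_BQP_holds` and decision
from the written bit `mem_BQP_of_isQSolvable_bit` conclude.
[cite: BennettBernsteinBrassardVazirani1997, Cor. 4.15 (BQP^BQP = BQP)] -/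
theorem toLanguage_mem_BQP_of_oracles {FB CU : Language Bool} {S : Set ℕ}
    (hFBiff : ∀ (N : ℕ) (u : List Bool),
      boolPair (encodeNat N) u ∈ FB ↔ (certCode N.primeFactorsList).getD u.length false = true)
    (hCUiff : ∀ d : ℕ, boolPair (encodeNat d) (certCode d.primeFactorsList) ∈ CU ↔ d ∈ S)
    (hFB : FB ∈ BQP) (hCU : CU ∈ BQP) : encodingNatBool.toLanguage S ∈ BQP := by
  obtain ⟨Q, hQfp, hQ⟩ := exists_queryFn (2 * (X + 1) ^ 2)
  obtain ⟨G, hGfp, hG⟩ := exists_outFn (2 * (X + 1) ^ 2)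
  have hp : ∀ n : ℕ, (certCode n.primeFactorsList).length ≤ (2 * (X + 1) ^ 2 : Polynomial ℕ).eval (encodeNat n).length :=
    fun n => by simpa using length_certCode_primeFactorsList_le n
  set bit : List Bool → Bool := fun x => decide (encodeNat (bitsToNat x) = x) &&
    CU.boolIndicator (boolPair x (certCode (bitsToNat x).primeFactorsList)) with hbit_def
  have hbit : ∀ x, bit x = true ↔ x ∈ encodingNatBool.toLanguage S := by
    intro x
    simp only [hbit_def, Bool.and_eq_true, decide_eq_true_eq]
    constructor
    · rintro ⟨hx, hmem⟩
      obtain ⟨d, rfl⟩ : ∃ d, x = encodeNat d := ⟨_, hx.symm⟩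
      rw [bitsToNat_encodeNat] at hmem
      exact (Computability.Encoding.mem_toLanguage_iff encodingNatBool S d).2
        ((hCUiff d).1 ((Set.mem_iff_boolIndicator _ _).2 hmem))
    · rintro ⟨d, hd, rfl⟩
      change encodeNat (bitsToNat (encodeNat d)) = encodeNat d ∧
        CU.boolIndicator (boolPair (encodeNat d) (certCode (bitsToNat (encodeNat d)).primeFactorsList)) = true
      rw [bitsToNat_encodeNat]
      exact ⟨rfl, (Set.mem_iff_boolIndicator _ _).1 ((hCUiff d).2 hd)⟩
  have hA : oracleJoin FB CU ∈ BQP := Literature.Computability.QuantumComplexity.oracleJoin_mem_BQP hFB hCU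
  have hT : adFn Q (2 * (X + 1) ^ 2 + 1) G (oracleJoin FB CU) ∘ fstF ∈
      FPRel (Oracle.ofLanguage (oracleJoin FB CU)) :=
    comp_FP_mem_FPRel (adFn_mem_FPRel hQfp hGfp _) fstF_mem_FP
  have hsolv : IsQSolvable fun x => {z | [bit x] <+: z} := by
    refine isQSolvable_of_mem_FPRel_BQP_holds (oracleJoin FB CU) _ 0 (fun x => {z | [bit x] <+: z})
      (fun x y hy z hyz => List.IsPrefix.trans hy hyz) hA hT fun x => ?_
    have hset : {c : List Bool | (adFn Q (2 * (X + 1) ^ 2 + 1) G (oracleJoin FB CU) ∘ fstF) (boolPair x c) ∈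
        {z | [bit x] <+: z}} = Set.univ := by
      refine Set.eq_univ_of_forall fun c => ?_
      simp only [Set.mem_setOf_eq, Function.comp_apply, fstF_boolPair]
      rw [adFn_eq_bit hQ hG hFBiff hp x]
    rw [hset, uniformProb_univ]
    norm_num
  exact mem_BQP_of_isQSolvable_bit (fun _ _ => QCircuit.outputPMF_apply_holds) cliffordT_isUnitary_holds hbit hsolv

/-- **Stub `stub_unitCubeMemBQP` of the line `mirror-unit-signature`** (crux `stmt-QuantumAdvantage-2427`):
the unit language `bin {d : −d fundamental, d ≠ 3, UnitCubeAtThree d}` is in `BQP` given the factor-bit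
language and the certified unit language in `BQP` — `toLanguage_mem_BQP_of_oracles` with the two literal
languages (`encodingListNatBool.encode = certCode`, `VDSOracle.encode_primeFactorsList_eq`; injectivity
of `boolPair` and `bin`). [cite: BennettBernsteinBrassardVazirani1997, Cor. 4.15 (BQP^BQP = BQP)] -/
theorem stub_unitCubeMemBQP :
    ({w : List Bool | ∃ (N : ℕ) (u : List Bool), w = boolPair (encodeNat N) u ∧
      (encodingListNatBool.encode (Nat.primeFactorsList N)).getD u.length false = true} ∈ BQP) →
    ({w : List Bool | ∃ d : ℕ, w = boolPair (encodeNat d) (encodingListNatBool.encode (Nat.primeFactorsList d)) ∧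
      ((((-(d:ℤ)) % 4 = 1 ∧ Squarefree (-(d:ℤ)) ∧ (-(d:ℤ)) ≠ 1) ∨
        (4 ∣ (-(d:ℤ)) ∧ ((-(d:ℤ)) / 4 % 4 = 2 ∨ (-(d:ℤ)) / 4 % 4 = 3) ∧ Squarefree ((-(d:ℤ)) / 4)))) ∧
      d ≠ 3 ∧ UnitCubeAtThree d} ∈ BQP) →
    encodingNatBool.toLanguage
      {d : ℕ | ((((-(d:ℤ)) % 4 = 1 ∧ Squarefree (-(d:ℤ)) ∧ (-(d:ℤ)) ≠ 1) ∨
          (4 ∣ (-(d:ℤ)) ∧ ((-(d:ℤ)) / 4 % 4 = 2 ∨ (-(d:ℤ)) / 4 % 4 = 3) ∧ Squarefree ((-(d:ℤ)) / 4)))) ∧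
        d ≠ 3 ∧ UnitCubeAtThree d} ∈ BQP := by
  intro hFB hCU
  refine toLanguage_mem_BQP_of_oracles (fun N u => ?_) (fun d => ?_) hFB hCU
  · simp only [VDSOracle.encode_primeFactorsList_eq]
    constructor
    · rintro ⟨N', u', h, hbit⟩
      obtain ⟨hN, rfl⟩ := Literature.Computability.QuantumComplexity.boolPair_inj.1 h
      rw [natE_injective hN]
      exact hbit
    · exact fun h => ⟨N, u, rfl, h⟩
  · simp only [VDSOracle.encode_primeFactorsList_eq]
    constructor
    · rintro ⟨d', h, hP⟩
      obtain ⟨hd, -⟩ := Literature.Computability.QuantumComplexity.boolPair_inj.1 h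
      rw [natE_injective hd]
      exact hP
    · exact fun h => ⟨d, rfl, h⟩

end Summit.QuantumAdvantage.QuantumAdvantage.Theorems.AvgFaceBeyondPrior.Mirror
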